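import Summits.FinalStateConjecture.FinalStateConjecture.Theses.MergerLatticeBudget
import Summits.FinalStateConjecture.FinalStateConjecture.Theses.QuietWindowCapture
import Literature.Geometry.Lorentzian.SoundNearKerrLeaf
import Literature.Geometry.Lorentzian.LocatedLeaf
import HarnessLib.Audit

/-!
# Strategist sketch (negation lens) — crux `QuietLeaves` (stmt-FinalStateConjecture-10910 / -10114)

The typed obstruction behind the two paper refutations `refuted-misstated` on the item
(refuter-rattack-10910-0, EVIDENCE.md 2026-08-15T16:59Z; refuter-rattack-10910-g2-0, EVIDENCE-g2.md
2026-08-15T20:17Z): for a CK-small admissible datum with a rough far tail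
`A·r^{-82}·sin(r^{20})·e(ω)` the maximal development has complete `𝓘⁺` (CK 1993 Thm 1.0.3) but the
`6`-jet of `g` is `ε`-far from flat IN EVERY FRAME AT EVERY (late/far) POINT, so no flat-background
chart of leaf type has an `(ε,6)`-quiet hyperboloidal slice.  The refuters recorded "no Lean `¬S`
possible — the antecedent needs a constructed MGHD".  What IS landable is the CONDITIONAL negative
lemma below: the construction hypothesis `SliceLoud 𝒟 k ε K` (chart-level loudness of every
leaf-type flat sheet beyond `J⁻(K)`) implies `¬ QuietLeaves` (both decls of the crux directory), and
also kills the load-bearing stub `stub_soundRecurrence` of the registered line `Lines/birth.lean`.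
Landing it under `Theorems/QuietLeaves/Negative/` (disprover seat) HOLDS the item via the
`route-negative-lemma` mechanism until either the witness development is constructed (CK-scale
formalisation) or the planner applies the pre-registered repair C′ (all-orders strong asymptotic
flatness of the datum, Repair.lean / Repair2.lean on the item).

Nothing here is asserted about any item; `SliceLoud` is a hypothesis, never constructed.
-/

noncomputable section

open scoped Manifold ContDiff Topology ENNReal
open Filter Set TopologicalSpace Literature.Geometry.Lorentzian

namespace Summit.FinalStateConjecture.FinalStateConjecture.Cruxes.QuietLeaves.Strategist

set_option linter.unusedVariables false
set_option linter.dupNamespace false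

section Loud

variable {X : Type} [TopologicalSpace X] [ChartedSpace E3 X] [IsManifold (𝓡 3) ∞ X]
  [ConnectedSpace X] {D : InitialDataSet (𝓡 3) X}

/-- **Chart-level loudness of flat sheets beyond `J⁻(K)`** (the construction hypothesis `H` of the
conditional negative lemma).  For every hole count `N`, spins `a`, tube radii `ρ`, motions `mo`,
every open `U₀ ⊆ E4` containing the hyperboloidal half-space `{t₀ > −1}` minus the Kerr-radius
tubes `{rᵢ ≤ ρᵢ}`, and every map `Ψ₀ : U₀ → 𝒟` which is smooth on the layer `{−1 < t₀ < 1}`, maps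
it into `J⁺(ι X)`, and whose slice image `Ψ₀ {t₀ = 0}` avoids `J⁻(K)`: the `Cᵏ` deviation of
`Ψ₀^* g` from `η` on the slice EXCEEDS `ε`.  (Flat background written with the anonymous
constructor exactly as inlined in the route items, so that the lemma below is plumbing.)
Paper witness: EVIDENCE-g2.md §3 on stmt-FinalStateConjecture-10910 (`k = 6`, `K = ∅`). -/
def SliceLoud (𝒟 : CauchyDevelopment D) (k : ℕ) (ε : ℝ≥0∞) (K : Set 𝒟.carrier) : Prop :=
  ∀ (N : ℕ) (a ρ : Fin N → ℝ) (mo : Fin N → lorentzGroup × E4) (U₀ : Opens E4)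
    (Ψ₀ : (⟨U₀, fun _ => Minkowski.bilin, fun x => x 0 - Real.sqrt (1 + E4.spatialNorm x ^ 2),
      E4.spatialNorm⟩ : ModelBackground).domain → 𝒟.carrier),
    {x : E4 | -1 < x 0 - Real.sqrt (1 + E4.spatialNorm x ^ 2) ∧
        ∀ i, ρ i < Kerr.radius (a i) (poincareInv (mo i).1 (mo i).2 x)} ⊆ (U₀ : Set E4) →
    ContMDiffOn 𝓘(ℝ, E4) (𝓡 4) ∞ Ψ₀
      {x | -1 < (⟨U₀, fun _ => Minkowski.bilin, fun x => x 0 - Real.sqrt (1 + E4.spatialNorm x ^ 2),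
        E4.spatialNorm⟩ : ModelBackground).time x.1 ∧
        (⟨U₀, fun _ => Minkowski.bilin, fun x => x 0 - Real.sqrt (1 + E4.spatialNorm x ^ 2),
          E4.spatialNorm⟩ : ModelBackground).time x.1 < 1} →
    Ψ₀ '' {x | -1 < (⟨U₀, fun _ => Minkowski.bilin,
        fun x => x 0 - Real.sqrt (1 + E4.spatialNorm x ^ 2), E4.spatialNorm⟩ : ModelBackground).time
          x.1 ∧ (⟨U₀, fun _ => Minkowski.bilin, fun x => x 0 - Real.sqrt (1 + E4.spatialNorm x ^ 2),
          E4.spatialNorm⟩ : ModelBackground).time x.1 < 1} ⊆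
      𝒟.metric.causalFuture 𝒟.timeOrientation (Set.range 𝒟.embed) →
    Disjoint (Ψ₀ '' (⟨U₀, fun _ => Minkowski.bilin,
        fun x => x 0 - Real.sqrt (1 + E4.spatialNorm x ^ 2), E4.spatialNorm⟩ :
          ModelBackground).timeSlab 0)
      (𝒟.metric.causalPast 𝒟.timeOrientation K) →
    ε < 𝒟.toSpacetime.deviationCk (⟨U₀, fun _ => Minkowski.bilin,
        fun x => x 0 - Real.sqrt (1 + E4.spatialNorm x ^ 2), E4.spatialNorm⟩ : ModelBackground)
      Ψ₀ k 0

/-- A loud development beyond `J⁻(K)` carries no typed `(ε,k)`-near-Kerr leaf beyond `J⁻(K)`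
(rev-3 thick block of route `MergerLatticeBudget`, any census): the flat-sheet clause fails. -/
theorem no_thick_leaf_of_sliceLoud {𝒟 : CauchyDevelopment D} {k : ℕ} {ε : ℝ≥0∞}
    {K : Set 𝒟.carrier} (hloud : SliceLoud 𝒟 k ε K) {N : ℕ} {M a : Fin N → ℝ}
    {S : Set 𝒟.carrier} (hdisj : Disjoint S (𝒟.metric.causalPast 𝒟.timeOrientation K))
    (hleaf : ∃ (R ρ : Fin N → ℝ) (mo : Fin N → lorentzGroup × E4) (r : Fin N → E4 → ℝ)
      (B : Fin N → ModelBackground) (U₀ : TopologicalSpace.Opens E4) (B₀ : ModelBackground)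
      (Ψ : ∀ i, (B i).domain → 𝒟.carrier) (Ψ₀ : B₀.domain → 𝒟.carrier)
      (L W : ∀ i, Set (B i).domain) (L₀ W₀ : Set B₀.domain),
      (∀ i, r i = fun x => Kerr.radius (a i) (poincareInv (mo i).1 (mo i).2 x)) ∧
      (∀ i, B i = (⟨⟨poincareInv (mo i).1 (mo i).2 ⁻¹' (Kerr.region (a i) (M i) : Set E4),
        (Kerr.region (a i) (M i)).isOpen.preimage (continuous_poincareInv (mo i).1 (mo i).2)⟩,
        boostedKerrBilin (mo i).1 (mo i).2 (M i) (a i), fun x => poincareInv (mo i).1 (mo i).2 x 0,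
        r i⟩ : ModelBackground)) ∧
      B₀ = (⟨U₀, fun _ => Minkowski.bilin, fun x => x 0 - Real.sqrt (1 + E4.spatialNorm x ^ 2),
        E4.spatialNorm⟩ : ModelBackground) ∧
      (∀ i, L i = {x | -1 < (B i).time x.1 ∧ (B i).time x.1 < 1 ∧ (B i).radius x.1 < R i + 1} ∧
        W i = {x | 0 < (B i).time x.1 ∧ (B i).time x.1 < 1 ∧ (B i).radius x.1 ≤ R i}) ∧
      L₀ = {x | -1 < B₀.time x.1 ∧ B₀.time x.1 < 1} ∧
      W₀ = {x | 0 < B₀.time x.1 ∧ B₀.time x.1 < 1} ∧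
      (∀ i, 0 < M i ∧ |a i| ≤ M i ∧ 0 < ρ i ∧ ρ i < R i ∧ 2 * M i ≤ R i) ∧
      {x : E4 | -1 < x 0 - Real.sqrt (1 + E4.spatialNorm x ^ 2) ∧ ∀ i, ρ i < r i x} ⊆
        (U₀ : Set E4) ∧
      (∀ i, ContMDiffOn 𝓘(ℝ, E4) (𝓡 4) ∞ (Ψ i) (L i) ∧
        Topology.IsOpenEmbedding ((L i).restrict (Ψ i)) ∧
        Ψ i '' L i ⊆ 𝒟.metric.causalFuture 𝒟.timeOrientation (Set.range 𝒟.embed)) ∧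
      ContMDiffOn 𝓘(ℝ, E4) (𝓡 4) ∞ Ψ₀ L₀ ∧ Topology.IsOpenEmbedding (L₀.restrict Ψ₀) ∧
      Ψ₀ '' L₀ ⊆ 𝒟.metric.causalFuture 𝒟.timeOrientation (Set.range 𝒟.embed) ∧
      (∀ i, 𝒟.toSpacetime.truncDeviationCk (B i) (Ψ i) k (R i) 0 ≤ ε) ∧
      𝒟.toSpacetime.deviationCk B₀ Ψ₀ k 0 ≤ ε ∧
      Pairwise (Function.onFun Disjoint fun i => Ψ i '' {x | x ∈ L i ∧ (B i).radius x.1 ≤ R i}) ∧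
      (∀ i, Ψ i '' {x | (B i).time x.1 = 0 ∧ ρ i < (B i).radius x.1 ∧ (B i).radius x.1 ≤ R i} ⊆
        Ψ₀ '' L₀) ∧
      (∀ i, Ψ₀ '' {x | B₀.time x.1 = 0 ∧ ρ i < r i x.1 ∧ r i x.1 < R i} ⊆ Ψ i '' L i) ∧
      S = Ψ₀ '' B₀.timeSlab 0 ∪ ⋃ i, Ψ i '' (B i).truncTimeSlab (R i) 0 ∧
      Ψ₀ '' W₀ ∪ ⋃ i, Ψ i '' W i ⊆ 𝒟.metric.chronologicalFuture 𝒟.timeOrientation S ∧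
      Summit.FinalStateConjecture.exteriorOf 𝒟 (Ψ₀ '' W₀ ∪ ⋃ i, Ψ i '' W i) \
          (Ψ₀ '' W₀ ∪ ⋃ i, Ψ i '' W i) ⊆
        𝒟.metric.causalPast 𝒟.timeOrientation S) : False := by
  obtain ⟨R, ρ, mo, r, B, U₀, B₀, Ψ, Ψ₀, L, W, L₀, W₀, h1, h2, h3, h4, h5, h6, h7, h8, h9, h10, h11,
    h12, h13, h14, h15, h16, h17, h18, h19, h20⟩ := hleaf
  subst h3
  subst h5
  have h8' : {x : E4 | -1 < x 0 - Real.sqrt (1 + E4.spatialNorm x ^ 2) ∧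
      ∀ i, ρ i < Kerr.radius (a i) (poincareInv (mo i).1 (mo i).2 x)} ⊆ (U₀ : Set E4) := by
    intro x hx
    refine h8 ⟨hx.1, fun i ↦ ?_⟩
    rw [h1 i]
    exact hx.2 i
  have hS : Ψ₀ '' (ModelBackground.timeSlab ⟨U₀, fun _ => Minkowski.bilin,
      fun x => x 0 - Real.sqrt (1 + E4.spatialNorm x ^ 2), E4.spatialNorm⟩ 0) ⊆ S := by
    rw [h18]
    exact subset_union_left
  have hlt := hloud N a ρ mo U₀ Ψ₀ h8' h10 h12 (hdisj.mono_left hS)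
  exact absurd h14 (not_le.mpr hlt)

end Loud

/-- **Conditional negative lemma (route `MergerLatticeBudget`, stmt-10910).**  If ONE admissible
datum has a maximal vacuum development with complete `𝓘⁺` which is `(ε,k)`-slice-loud beyond
`J⁻(K)` for some `k`, some `ε > 0` and some compact `K`, then `QuietLeaves` (rev-3 block) is false. -/
theorem not_quietLeaves_of_sliceLoud
    (X : Type) [TopologicalSpace X] [ChartedSpace E3 X] [IsManifold (𝓡 3) ∞ X] [T2Space X]
    [SecondCountableTopology X] [ConnectedSpace X] (D : InitialDataSet (𝓡 3) X)
    (hD : D ∈ admissibleVacuumData X) (𝒟 : VacuumCauchyDevelopment D) (hmax : 𝒟.IsMaximal)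
    (hscri : Summit.FinalStateConjecture.HasCompleteNullInfinity 𝒟.toCauchyDevelopment)
    (k : ℕ) (ε : ℝ≥0∞) (hε : 0 < ε) (K : Set 𝒟.carrier) (hK : IsCompact K)
    (hloud : SliceLoud 𝒟.toCauchyDevelopment k ε K) :
    ¬ Theses.MergerLatticeBudget.QuietLeaves := by
  intro hQL
  obtain ⟨N₀, m₀, hm₀, h⟩ := hQL X D hD 𝒟 hmax hscri
  obtain ⟨N, M, a, S, hN, hM, hdisj, hleaf⟩ := h k ε hε K hK
  exact no_thick_leaf_of_sliceLoud hloud hdisj hleaf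

/-- The same hypothesis kills the rev-1 block (route `QuietWindowCapture`, stmt-10114): a rev-1 leaf
lacks only the clause `2Mᵢ ≤ Rᵢ`, which the contradiction does not use. -/
theorem not_quietLeavesQWC_of_sliceLoud
    (X : Type) [TopologicalSpace X] [ChartedSpace E3 X] [IsManifold (𝓡 3) ∞ X] [T2Space X]
    [SecondCountableTopology X] [ConnectedSpace X] (D : InitialDataSet (𝓡 3) X)
    (hD : D ∈ admissibleVacuumData X) (𝒟 : VacuumCauchyDevelopment D) (hmax : 𝒟.IsMaximal)
    (hscri : Summit.FinalStateConjecture.HasCompleteNullInfinity 𝒟.toCauchyDevelopment)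
    (k : ℕ) (ε : ℝ≥0∞) (hε : 0 < ε) (K : Set 𝒟.carrier) (hK : IsCompact K)
    (hloud : SliceLoud 𝒟.toCauchyDevelopment k ε K) :
    ¬ Theses.QuietWindowCapture.QuietLeaves := by
  intro hQL
  obtain ⟨N₀, m₀, hm₀, h⟩ := hQL X D hD 𝒟 hmax hscri
  obtain ⟨N, M, a, S, hN, hM, hdisj, hleaf⟩ := h k ε hε K hK
  obtain ⟨R, ρ, mo, r, B, U₀, B₀, Ψ, Ψ₀, L, W, L₀, W₀, h1, h2, h3, h4, h5, h6, h7, h8, h9, h10, h11,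
    h12, h13, h14, h15, h16, h17, h18, h19, h20⟩ := hleaf
  subst h3
  subst h5
  have h8' : {x : E4 | -1 < x 0 - Real.sqrt (1 + E4.spatialNorm x ^ 2) ∧
      ∀ i, ρ i < Kerr.radius (a i) (poincareInv (mo i).1 (mo i).2 x)} ⊆ (U₀ : Set E4) := by
    intro x hx
    refine h8 ⟨hx.1, fun i ↦ ?_⟩
    rw [h1 i]
    exact hx.2 i
  have hS : Ψ₀ '' (ModelBackground.timeSlab ⟨U₀, fun _ => Minkowski.bilin,
      fun x => x 0 - Real.sqrt (1 + E4.spatialNorm x ^ 2), E4.spatialNorm⟩ 0) ⊆ S := by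
    rw [h18]
    exact subset_union_left
  have hlt := hloud N a ρ mo U₀ Ψ₀ h8' h10 h12 (hdisj.mono_left hS)
  exact absurd h14 (not_le.mpr hlt)

/-- The same hypothesis kills the load-bearing stub `stub_soundRecurrence` of the registered line
`Lines/birth.lean` (its statement, verbatim): a sound leaf is a typed leaf. -/
theorem not_stub_soundRecurrence_of_sliceLoud
    (X : Type) [TopologicalSpace X] [ChartedSpace E3 X] [IsManifold (𝓡 3) ∞ X] [T2Space X]
    [SecondCountableTopology X] [ConnectedSpace X] (D : InitialDataSet (𝓡 3) X)
    (hD : D ∈ admissibleVacuumData X) (𝒟 : VacuumCauchyDevelopment D) (hmax : 𝒟.IsMaximal)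
    (hscri : Summit.FinalStateConjecture.HasCompleteNullInfinity 𝒟.toCauchyDevelopment)
    (k : ℕ) (ε : ℝ≥0∞) (hε : 0 < ε) (K : Set 𝒟.carrier) (hK : IsCompact K)
    (hloud : SliceLoud 𝒟.toCauchyDevelopment k ε K) :
    ¬ (∀ (X : Type) [TopologicalSpace X] [ChartedSpace E3 X] [IsManifold (𝓡 3) ∞ X] [T2Space X]
      [SecondCountableTopology X] [ConnectedSpace X] (D : InitialDataSet (𝓡 3) X),
      D ∈ admissibleVacuumData X → ∀ 𝒟 : VacuumCauchyDevelopment D, 𝒟.IsMaximal →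
      Summit.FinalStateConjecture.HasCompleteNullInfinity 𝒟.toCauchyDevelopment →
      ∀ (k : ℕ) (ε : ℝ≥0∞), 0 < ε → ∀ K : Set 𝒟.carrier, IsCompact K →
        ∃ (N : ℕ) (M a : Fin N → ℝ) (S : Set 𝒟.carrier),
          Disjoint S (𝒟.metric.causalPast 𝒟.timeOrientation K) ∧
          𝒟.toCauchyDevelopment.IsSoundNearKerrLeaf k ε N M a S) := by
  intro hstub
  obtain ⟨N, M, a, S, hdisj, hleaf⟩ := hstub X D hD 𝒟 hmax hscri k ε hε K hK
  have htyped := hleaf.isNearKerrLeaf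
  obtain ⟨R, ρ, mo, r, B, U₀, B₀, Ψ, Ψ₀, L, W, L₀, W₀, h1, h2, h3, h4, h5, h6, h7, h8, h9, h10, h11,
    h12, h13, h14, h15, h16, h17, h18, h19, h20⟩ := htyped
  subst h3
  subst h5
  have h8' : {x : E4 | -1 < x 0 - Real.sqrt (1 + E4.spatialNorm x ^ 2) ∧
      ∀ i, ρ i < Kerr.radius (a i) (poincareInv (mo i).1 (mo i).2 x)} ⊆ (U₀ : Set E4) := by
    intro x hx
    refine h8 ⟨hx.1, fun i ↦ ?_⟩
    rw [h1 i]
    exact hx.2 i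
  have hS : Ψ₀ '' ((hypBackground U₀).timeSlab 0) ⊆ S := by
    rw [h18]
    exact subset_union_left
  have hlt := hloud N a ρ mo U₀ Ψ₀ h8' h10 h12 (hdisj.mono_left hS)
  exact absurd h14 (not_le.mpr hlt)

/-- **Packaged construction hypothesis** (the `H` of the `route-negative-lemma` hold): an
admissible datum with a maximal vacuum development, complete `𝓘⁺`, which is `(ε,k)`-slice-loud
beyond `J⁻(K)` for some `k`, `ε > 0`, compact `K`.  On paper: the CK-recipe datum with far tail
`A·r^{-82}·sin(r^{20})·e(ω)` at `k = 6`, `K = ∅` (EVIDENCE-g2.md §3 on stmt-10910); in Lean it needs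
the Christodoulou–Klainerman global existence theorem for that datum — not constructible today. -/
structure LoudCompleteDevelopment where
  /-- the Cauchy hypersurface -/
  X : Type
  [top : TopologicalSpace X]
  [charted : ChartedSpace E3 X]
  [mfd : IsManifold (𝓡 3) ∞ X]
  [t2 : T2Space X]
  [sc : SecondCountableTopology X]
  [conn : ConnectedSpace X]
  /-- the admissible datum -/
  D : InitialDataSet (𝓡 3) X
  admissible : D ∈ admissibleVacuumData X
  /-- its maximal development with complete `𝓘⁺` -/
  𝒟 : VacuumCauchyDevelopment D
  maximal : 𝒟.IsMaximal
  scri : Summit.FinalStateConjecture.HasCompleteNullInfinity 𝒟.toCauchyDevelopment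
  /-- the loud order, tolerance and compact set -/
  k : ℕ
  ε : ℝ≥0∞
  ε_pos : 0 < ε
  K : Set 𝒟.carrier
  compact : IsCompact K
  loud : SliceLoud 𝒟.toCauchyDevelopment k ε K

attribute [instance] LoudCompleteDevelopment.top LoudCompleteDevelopment.charted
  LoudCompleteDevelopment.mfd LoudCompleteDevelopment.t2 LoudCompleteDevelopment.sc
  LoudCompleteDevelopment.conn

/-- `H`: a loud complete development exists. -/
def LoudCompleteDevelopmentExists : Prop := Nonempty LoudCompleteDevelopment

/-- `H → ¬ QuietLeaves` (route `MergerLatticeBudget`, stmt-10910). -/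
theorem not_quietLeaves_of_loudCompleteDevelopmentExists (h : LoudCompleteDevelopmentExists) :
    ¬ Theses.MergerLatticeBudget.QuietLeaves := by
  obtain ⟨w⟩ := h
  exact not_quietLeaves_of_sliceLoud w.X w.D w.admissible w.𝒟 w.maximal w.scri w.k w.ε w.ε_pos
    w.K w.compact w.loud

/-- `H → ¬ QuietLeaves` (route `QuietWindowCapture`, stmt-10114). -/
theorem not_quietLeavesQWC_of_loudCompleteDevelopmentExists (h : LoudCompleteDevelopmentExists) :
    ¬ Theses.QuietWindowCapture.QuietLeaves := by
  obtain ⟨w⟩ := h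
  exact not_quietLeavesQWC_of_sliceLoud w.X w.D w.admissible w.𝒟 w.maximal w.scri w.k w.ε w.ε_pos
    w.K w.compact w.loud

end Summit.FinalStateConjecture.FinalStateConjecture.Cruxes.QuietLeaves.Strategist

end
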